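import Summits.QuantumFields.BalabanUV.Beta.EriceFlowEnclosureB12AsPrintedPointwiseFadingOrder

/-!
# Beta / EriceFlowEnclosureB12AsPrintedPointwiseFadingOrderInterval — WHAT (0.31) FORCES POINTWISE, part 7b: UNDER FADING MEMORY THE ADMISSIBLE BARE COUPLINGS
# FORM AN INTERVAL.  Part 7 (`…PointwiseFadingOrder`) read the same-length discrepancy FORWARD and found the order of the couplings free under node U2's
# coupling-chart moduli `HistLipschitz Λ γ β` ∕ `FadingMemory C θ Λ` (0 ≤ θ < 1, 4Cγ³ ≤ (1−θ)²).  Here the same forward step is run ONE SCALE AHEAD of the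
# recursion (**`virtual_link`**: the would-be next values 1∕g_k² − β_{k+1}(g_{≤k}) of two length-k runs are still ρ-separated), which is what a SANDWICH needs:
# a sequence h that solves (0.20) forward WHEREVER SOLVABLE (print's (0.20) in the forward-determination form `Definitions.d020`: runs that break off are not
# objects of the text) and starts BETWEEN the bare couplings of two in-box runs g, g′ of length K never breaks off, solves (0.20) to depth K, and stays between
# them at every scale (**`sandwich`**) — so on the carrier the set of bare couplings whose run (K, m, ·) stays in ]0, γ] is ORDER-CONNECTED (an interval,
# **`admissible_ordConnected`**), the renormalized coupling is STRICTLY INCREASING on it, and with Theorem 2 AS TYPED it takes every value of ]0, g₁] exactly once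
# (**`theorem2_bareCoupling_interval_signFree`**): on every lattice «g₀ = g₀(ε, ·)» is the inverse of a strictly increasing function on an interval — sign-free,
# AF-free, no uniform reading
# (β-flow team, prover 2 = lower ∕ positivity side, unit `b2b-balaban-beta-bflow-p2`, gen 44; ROW AP-I × node U2's letters; companion of parts 7 ∕ 7 END)

HONEST FRAMING (page 1 of everything the β sub-cell writes): discharging `BetaPertH` makes Bałaban's UV stability UNCONDITIONAL — a
real constructive-QFT result; it is NOT the continuum limit and NOT the Clay problem.  HONEST DEPENDENCY (cell reorg 2026-08-19,
verbatim): «continuum YM on T⁴ ⇐ BetaPertH ∧ nine spine estimates (0/9 proved); BetaPertH ⇐ (D1) ∧ (D4) ∧ CAP+tail; G-an2-4 gates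
asym, D1 and NE2/3/4.»  THIS MODULE DISCHARGES NOTHING: §1 is elementary real analysis for an ABSTRACT history-dependent family `β : FlowStep.HBeta` under
node U2's HYPOTHESIS SHAPES (NOT printed; [I] = T. Bałaban, Commun. Math. Phys. **109** (1987) [Balaban1987RG1] p. 298 states the history dependence only;
GAPS G-t4-U2-2); §2 reads it on the statement-exact carrier `B12BetaAsPrinted` through the printed `Definitions` ((0.18) `d018`, (0.20) `d020` p. 256 in its
forward-determination form — custodian's DELTA-I D-4) and the upper letter (U) (p. 264 «uniformly bounded»; only to make (0.20) solvable inside the box,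
`…TunedUpper.hrg_of_betaUpperH`); `Theorem2Statement` (STATED WITHOUT PROOF, p. 259) is a HYPOTHESIS of the END.  Nothing of Bałaban's (1.22) is asserted.

WHAT THIS FILE PROVES (0 sorry, 0 def):
§1 (any `β : HBeta`) **`virtual_link`** (ρ·(1∕g_k² − 1∕g′_k²) ≤ (1∕g_k² − β_{k+1}(g_{≤k})) − (1∕g′_k² − β_{k+1}(g′_{≤k})) for two length-k runs with g_0 < g′_0),
   **`sandwich`** (a forward-solvable sequence starting between two in-box runs solves (0.20) to their depth and stays between them).
§2 (carrier) **`cpl_sandwich`**, **`admissible_ordConnected`** (the admissible bare couplings at (K, m, γ) form an interval), `endpoint_strictMonoOn`,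
   END **`theorem2_bareCoupling_interval_signFree`** (Theorem 2 AS TYPED + `Definitions` + (U) + the moduli: on every lattice the admissible bare couplings form
   an interval on which g_K is strictly increasing and takes each value of ]0, g₁] exactly once).
NOT CLAIMED: any modulus, sign or bound for Bałaban's β; which reading print intends; Theorem 2; `BetaPertH`; continuum; Clay.
-/

namespace Summit.QuantumFields.BalabanUV.Beta.EriceFlowEnclosureB12AsPrintedPointwiseFadingOrderInterval

open Finset
open Literature.MathematicalPhysics.QuantumFieldTheory.Balaban1983to89
open Literature.MathematicalPhysics.QuantumFieldTheory.Balaban1983to89.B12BetaAsPrinted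
open Literature.MathematicalPhysics.QuantumFieldTheory.Balaban1983to89.FlowStep (HBeta prefixOf Box mem_box box_mono RGEqH BetaUpperH)
open Literature.MathematicalPhysics.QuantumFieldTheory.Balaban1983to89.T4CouplingMatching (HistLipschitz FadingMemory abs_sub_le_of_inv_sq)
open Summit.QuantumFields.BalabanUV.Beta.EriceFlowEnclosureB12AsPrintedUpper (tunedRuns_of_theorem2Statement)
open Summit.QuantumFields.BalabanUV.Beta.EriceFlowEnclosureB12AsPrintedTunedUpper (hrg_of_betaUpperH)
open Summit.QuantumFields.BalabanUV.Beta.EriceFlowEnclosureB12AsPrintedHistoryUniqueMono (geom_tail_le)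
open Summit.QuantumFields.BalabanUV.Beta.EriceFlowEnclosureB12AsPrintedPointwiseFadingOrder

noncomputable section

/-! ## §1 The forward step one scale ahead of the recursion, and the sandwich -/

section General

variable {β : HBeta}

/-- **THE VIRTUAL LINK.**  Two runs g, g′ of (0.20) of length k (`RGEqH k β`) for one history-dependent β, couplings in ]0, γ] up to scale k, coupling-chart
moduli `HistLipschitz Λ γ β` with `FadingMemory C θ Λ` (0 ≤ θ < 1, 0 ≤ C), `4Cγ³ ≤ (1 − θ)²`, g_0 < g′_0: the WOULD-BE next values of 1∕g² are still separated,
`((1+θ)∕2)·(1∕g_k² − 1∕g′_k²) ≤ (1∕g_k² − β_{k+1}(g_{≤k})) − (1∕g′_k² − β_{k+1}(g′_{≤k}))` — part 7's `sep_geometric` supplies the chain below k, the fading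
feedback at scale k is ≤ (1 − ρ)·Δ_k as there; no step k of (0.20) is assumed for either run. [cite: Balaban1987RG1, (0.20) p.256 with p.298] -/
theorem virtual_link {γ θ C : ℝ} {Λ : ℕ → ℕ → ℝ} {k : ℕ} {g g' : ℕ → ℝ}
    (hθ0 : 0 ≤ θ) (hθ1 : θ < 1) (hC : 0 ≤ C) (hg : RGEqH k β g) (hg' : RGEqH k β g')
    (hbox : ∀ i, i ≤ k → 0 < g i ∧ g i ≤ γ) (hbox' : ∀ i, i ≤ k → 0 < g' i ∧ g' i ≤ γ)
    (hL : HistLipschitz Λ γ β) (hΛ : FadingMemory C θ Λ) (hsmall : 4 * C * γ ^ 3 ≤ (1 - θ) ^ 2) (h0 : g 0 < g' 0) :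
    (1 + θ) / 2 * (1 / (g k) ^ 2 - 1 / (g' k) ^ 2)
      ≤ (1 / (g k) ^ 2 - β k (prefixOf g k)) - (1 / (g' k) ^ 2 - β k (prefixOf g' k)) := by
  set ρ : ℝ := (1 + θ) / 2 with hρ
  set Δ : ℕ → ℝ := fun j => 1 / (g j) ^ 2 - 1 / (g' j) ^ 2 with hΔ
  clear_value Δ ρ
  have hρpos : 0 < ρ := by rw [hρ]; linarith
  have hθρ : θ < ρ := by rw [hρ]; linarith
  have hq0 : 0 ≤ θ / ρ := div_nonneg hθ0 hρpos.le
  have hq1 : θ / ρ < 1 := (div_lt_one hρpos).mpr hθρ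
  have hg0 := hbox 0 (Nat.zero_le _)
  have hγ : 0 ≤ γ := le_trans hg0.1.le hg0.2
  have hCγ : 0 ≤ C * γ ^ 3 := by positivity
  have hkey : C * γ ^ 3 * (1 / (1 - θ / ρ)) ≤ 1 - ρ := by
    have h1 : 1 - θ / ρ = (1 - θ) / (1 + θ) := by
      rw [hρ]; field_simp; ring
    have h1θ : 0 < 1 - θ := by linarith
    rw [h1, one_div_div, show (1 : ℝ) - ρ = (1 - θ) / 2 by rw [hρ]; ring, mul_div_assoc', div_le_iff₀ h1θ]
    nlinarith [mul_nonneg hCγ h1θ.le]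
  have hΔ0 : 0 < Δ 0 := by
    have := one_div_lt_one_div_of_lt (pow_pos hg0.1 2) (sq_lt_sq' (by linarith [hg0.1, (hbox' 0 (Nat.zero_le _)).1]) h0)
    simp only [hΔ]; linarith
  -- the chain below k, from part 7
  have hch : ∀ j, j < k → ρ * Δ j ≤ Δ (j + 1) := fun j hj => by
    have h := sep_geometric hθ0 hθ1 hC hg hg' hbox hbox' hL hΛ hsmall h0 j hj
    simp only [hΔ, hρ]; exact h
  have hdom : ∀ i, i ≤ k → ρ ^ (k - i) * Δ i ≤ Δ k := le_of_chain hρpos.le k hch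
  have hΔk : 0 < Δ k := lt_of_lt_of_le (mul_pos (pow_pos hρpos _) hΔ0) (hdom 0 (Nat.zero_le _))
  -- the fading feedback at scale k
  have hp : prefixOf g k ∈ Box γ k := T4CouplingMatching.prefixOf_mem_box le_rfl hbox
  have hp' : prefixOf g' k ∈ Box γ k := T4CouplingMatching.prefixOf_mem_box le_rfl hbox'
  have h2 := hL k (prefixOf g k) (prefixOf g' k) hp hp'
  have hterm : ∀ i ∈ range (k + 1),
      Λ k i * ((g i) ^ 2 * g' i) * |Δ i| ≤ C * γ ^ 3 * Δ k * (θ / ρ) ^ (k + 1 - 1 - i) := by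
    intro i hi
    have hik : i ≤ k := Nat.lt_succ_iff.mp (mem_range.mp hi)
    have hΔi : 0 < Δ i := lt_of_lt_of_le (mul_pos (pow_pos hρpos _) hΔ0)
      (le_of_chain hρpos.le i (fun l hl => hch l (lt_of_lt_of_le hl hik)) 0 (Nat.zero_le _))
    have hΔi_le : Δ i ≤ Δ k / ρ ^ (k - i) := by
      rw [le_div_iff₀ (pow_pos hρpos _), mul_comm]; exact hdom i hik
    have hw : (g i) ^ 2 * g' i ≤ γ ^ 3 := by
      calc (g i) ^ 2 * g' i ≤ γ ^ 2 * γ := mul_le_mul (pow_le_pow_left₀ (hbox i hik).1.le (hbox i hik).2 2)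
            (hbox' i hik).2 (hbox' i hik).1.le (sq_nonneg γ)
        _ = γ ^ 3 := by ring
    have hw0 : 0 ≤ (g i) ^ 2 * g' i := mul_nonneg (sq_nonneg _) (hbox' i hik).1.le
    have hΛi := hΛ k i hik
    rw [abs_of_pos hΔi, show k + 1 - 1 - i = k - i by omega]
    calc Λ k i * ((g i) ^ 2 * g' i) * Δ i
        ≤ C * θ ^ (k - i) * γ ^ 3 * (Δ k / ρ ^ (k - i)) :=
          mul_le_mul (mul_le_mul hΛi.2 hw hw0 (by positivity)) hΔi_le hΔi.le (by positivity)
      _ = C * γ ^ 3 * Δ k * (θ / ρ) ^ (k - i) := by rw [div_pow]; ring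
  have h3 : ∑ i : Fin (k + 1), Λ k i * |prefixOf g k i - prefixOf g' k i|
      ≤ ∑ i ∈ range (k + 1), Λ k i * ((g i) ^ 2 * g' i) * |Δ i| := by
    rw [Finset.sum_range (fun i => Λ k i * ((g i) ^ 2 * g' i) * |Δ i|)]
    refine Finset.sum_le_sum fun i _ => ?_
    have hik : (i : ℕ) ≤ k := Nat.lt_succ_iff.mp i.isLt
    simp only [FlowStep.prefixOf_apply, hΔ]
    rw [mul_assoc]
    exact mul_le_mul_of_nonneg_left (abs_sub_le_of_inv_sq (hbox i hik).1 (hbox' i hik).1) (hΛ k i hik).1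
  have hsum : ∑ i ∈ range (k + 1), Λ k i * ((g i) ^ 2 * g' i) * |Δ i| ≤ C * γ ^ 3 * (1 / (1 - θ / ρ)) * Δ k := by
    calc ∑ i ∈ range (k + 1), Λ k i * ((g i) ^ 2 * g' i) * |Δ i|
        ≤ ∑ i ∈ range (k + 1), C * γ ^ 3 * Δ k * (θ / ρ) ^ (k + 1 - 1 - i) := Finset.sum_le_sum hterm
      _ = C * γ ^ 3 * Δ k * ∑ i ∈ range (k + 1), (θ / ρ) ^ (k + 1 - 1 - i) := by rw [← Finset.mul_sum]
      _ = C * γ ^ 3 * Δ k * ∑ i ∈ range (k + 1), (θ / ρ) ^ i := by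
          rw [Finset.sum_range_reflect (fun i => (θ / ρ) ^ i) (k + 1)]
      _ ≤ C * γ ^ 3 * Δ k * (1 / (1 - θ / ρ)) := by
          refine mul_le_mul_of_nonneg_left ?_ (mul_nonneg hCγ hΔk.le)
          have h := geom_tail_le hq0 hq1 0 (k + 1)
          simp only [Nat.Ico_zero_eq_range, Nat.sub_zero] at h
          exact h
      _ = C * γ ^ 3 * (1 / (1 - θ / ρ)) * Δ k := by ring
  have hprod : C * γ ^ 3 * (1 / (1 - θ / ρ)) * Δ k ≤ (1 - ρ) * Δ k := mul_le_mul_of_nonneg_right hkey hΔk.le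
  have h4 := (le_abs_self (β k (prefixOf g k) - β k (prefixOf g' k))).trans (h2.trans h3)
  have hΔk' : Δ k = 1 / (g k) ^ 2 - 1 / (g' k) ^ 2 := by simp only [hΔ]
  rw [← hΔk']
  nlinarith [h4, hsum, hprod, hΔk]

/-- **THE SANDWICH.**  Two runs g, g′ of (0.20) of length K in ]0, γ] under part 7's moduli and smallness, and a sequence h that STARTS BETWEEN their bare
couplings (g_0 ≤ h_0 ≤ g′_0) and solves (0.20) FORWARD WHEREVER SOLVABLE (whenever h_0, …, h_k > 0 and 1∕h_k² − β_{k+1}(h_{≤k}) > 0, h_{k+1} is the positive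
solution — the shape of `Definitions.d020` ∕ `FlowStepRuns.flow_eq_of_rgEqH`): then h never breaks off — it solves (0.20) to depth K — and g_j ≤ h_j ≤ g′_j at
EVERY scale j ≤ K (induction on the depth; at each scale `virtual_link` against g′ makes the would-be value positive and below g′'s, against g above g's;
equal starts are `fwd_unique`). [cite: Balaban1987RG1, (0.20) p.256 with p.298] -/
theorem sandwich {γ θ C : ℝ} {Λ : ℕ → ℕ → ℝ} {K : ℕ} {g g' h : ℕ → ℝ}
    (hθ0 : 0 ≤ θ) (hθ1 : θ < 1) (hC : 0 ≤ C) (hg : RGEqH K β g) (hg' : RGEqH K β g')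
    (hbox : ∀ i, i ≤ K → 0 < g i ∧ g i ≤ γ) (hbox' : ∀ i, i ≤ K → 0 < g' i ∧ g' i ≤ γ)
    (hL : HistLipschitz Λ γ β) (hΛ : FadingMemory C θ Λ) (hsmall : 4 * C * γ ^ 3 ≤ (1 - θ) ^ 2)
    (hstep : ∀ k, k < K → (∀ i, i ≤ k → 0 < h i) → 0 < 1 / (h k) ^ 2 - β k (prefixOf h k) →
      0 < h (k + 1) ∧ 1 / (h (k + 1)) ^ 2 = 1 / (h k) ^ 2 - β k (prefixOf h k))
    (hlo : g 0 ≤ h 0) (hhi : h 0 ≤ g' 0) :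
    RGEqH K β h ∧ ∀ j, j ≤ K → g j ≤ h j ∧ h j ≤ g' j := by
  suffices Q : ∀ n, n ≤ K → RGEqH n β h ∧ ∀ j, j ≤ n → g j ≤ h j ∧ h j ≤ g' j from Q K le_rfl
  intro n
  induction n with
  | zero =>
    intro _
    exact ⟨fun k hk => absurd hk (Nat.not_lt_zero _), fun j hj => by obtain rfl := Nat.le_zero.mp hj; exact ⟨hlo, hhi⟩⟩
  | succ n ih =>
    intro hn1
    have hnK : n < K := Nat.lt_of_succ_le hn1
    obtain ⟨hrh, hord⟩ := ih hnK.le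
    -- data up to scale n
    have hboxn : ∀ i, i ≤ n → 0 < g i ∧ g i ≤ γ := fun i hi => hbox i (hi.trans hnK.le)
    have hboxn' : ∀ i, i ≤ n → 0 < g' i ∧ g' i ≤ γ := fun i hi => hbox' i (hi.trans hnK.le)
    have hboxh : ∀ i, i ≤ n → 0 < h i ∧ h i ≤ γ := fun i hi =>
      ⟨(hboxn i hi).1.trans_le (hord i hi).1, (hord i hi).2.trans (hboxn' i hi).2⟩
    have hposh : ∀ i, i ≤ n → 0 < h i := fun i hi => (hboxh i hi).1
    have hgn : RGEqH n β g := fun k hk => hg k (hk.trans hnK)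
    have hgn' : RGEqH n β g' := fun k hk => hg' k (hk.trans hnK)
    have eg : 1 / (g n) ^ 2 - β n (prefixOf g n) = 1 / (g (n + 1)) ^ 2 := by have := hg n hnK; linarith
    have eg' : 1 / (g' n) ^ 2 - β n (prefixOf g' n) = 1 / (g' (n + 1)) ^ 2 := by have := hg' n hnK; linarith
    have hgn1 := hbox (n + 1) hn1
    have hgn1' := hbox' (n + 1) hn1
    -- the would-be value of h at scale n + 1, compared with g′ (above) and g (below)
    have hv_ge : 1 / (g' (n + 1)) ^ 2 ≤ 1 / (h n) ^ 2 - β n (prefixOf h n) := by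
      rcases lt_or_eq_of_le (hord 0 (Nat.zero_le _)).2 with hlt | heq
      · have hl := virtual_link hθ0 hθ1 hC hrh hgn' hboxh hboxn' hL hΛ hsmall hlt
        have hΔ : 0 ≤ 1 / (h n) ^ 2 - 1 / (g' n) ^ 2 := by
          have := one_div_le_one_div_of_le (pow_pos (hposh n le_rfl) 2)
            (pow_le_pow_left₀ (hposh n le_rfl).le (hord n le_rfl).2 2)
          linarith
        nlinarith [hl, hΔ, eg']
      · have hall := fwd_unique hrh hgn' hposh (fun i hi => (hboxn' i hi).1) heq
        have hpre : prefixOf h n = prefixOf g' n := funext fun i => by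
          simp only [FlowStep.prefixOf_apply]; exact hall i (Nat.lt_succ_iff.mp i.isLt)
        rw [hpre, hall n le_rfl, eg']
    have hv_le : 1 / (h n) ^ 2 - β n (prefixOf h n) ≤ 1 / (g (n + 1)) ^ 2 := by
      rcases lt_or_eq_of_le (hord 0 (Nat.zero_le _)).1 with hlt | heq
      · have hl := virtual_link hθ0 hθ1 hC hgn hrh hboxn hboxh hL hΛ hsmall hlt
        have hΔ : 0 ≤ 1 / (g n) ^ 2 - 1 / (h n) ^ 2 := by
          have := one_div_le_one_div_of_le (pow_pos (hboxn n le_rfl).1 2)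
            (pow_le_pow_left₀ (hboxn n le_rfl).1.le (hord n le_rfl).1 2)
          linarith
        nlinarith [hl, hΔ, eg]
      · have hall := fwd_unique hgn hrh (fun i hi => (hboxn i hi).1) hposh heq
        have hpre : prefixOf h n = prefixOf g n := funext fun i => by
          simp only [FlowStep.prefixOf_apply]; exact (hall i (Nat.lt_succ_iff.mp i.isLt)).symm
        rw [hpre, ← hall n le_rfl, eg]
    have hvpos : 0 < 1 / (h n) ^ 2 - β n (prefixOf h n) := lt_of_lt_of_le (one_div_pos.mpr (pow_pos hgn1'.1 2)) hv_ge
    obtain ⟨hpos1, heq1⟩ := hstep n hnK hposh hvpos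
    refine ⟨fun k hk => ?_, fun j hj => ?_⟩
    · rcases lt_or_eq_of_le (Nat.lt_succ_iff.mp hk) with hkn | rfl
      · exact hrh k hkn
      · linarith [heq1]
    · rcases lt_or_eq_of_le hj with hjn | rfl
      · exact hord j (Nat.lt_succ_iff.mp hjn)
      · -- back to the couplings (`EriceRemainderEnclosureHistoryAutonomyMonotoneFlat.le_of_one_div_sq_le'`, inlined to keep the import chain)
        rw [← heq1] at hv_ge hv_le
        exact ⟨(pow_le_pow_iff_left₀ hgn1.1.le hpos1.le two_ne_zero).mp
            ((one_div_le_one_div (pow_pos hpos1 2) (pow_pos hgn1.1 2)).mp hv_le),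
          (pow_le_pow_iff_left₀ hpos1.le hgn1'.1.le two_ne_zero).mp
            ((one_div_le_one_div (pow_pos hgn1'.1 2) (pow_pos hpos1 2)).mp hv_ge)⟩

end General

/-! ## §2 On the carrier: the admissible bare couplings form an interval; the END with Theorem 2 -/

variable {S : Setting}

/-- **THE SANDWICH ON THE CARRIER.**  For a setting with the printed `Definitions` ((0.18) `d018`, (0.20) in forward-determination form `d020`): two runs
(K, m, g₀), (K, m, g₀′) obeying (0.20) and staying in ]0, γ], under part 7's moduli `HistLipschitz Λ γ S.β`, `FadingMemory C θ Λ` (0 ≤ θ < 1, 0 ≤ C) and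
`4Cγ³ ≤ (1 − θ)²` ⟹ for EVERY bare coupling y between g₀ and g₀′ the run (K, m, y) obeys (0.20), stays in ]0, γ], and lies between the two runs at every
scale. [cite: Balaban1987RG1, (0.18)–(0.20) pp.255–256 with p.298] -/
theorem cpl_sandwich (hD : Definitions S) {γ θ C : ℝ} {Λ : ℕ → ℕ → ℝ}
    (hθ0 : 0 ≤ θ) (hθ1 : θ < 1) (hC : 0 ≤ C) (hL : HistLipschitz Λ γ S.β) (hΛ : FadingMemory C θ Λ)
    (hsmall : 4 * C * γ ^ 3 ≤ (1 - θ) ^ 2) {K m : ℕ} {g₀ g₀' y : ℝ}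
    (hrg : RGEqH K S.β (S.cpl ⟨K, m, g₀⟩)) (hrg' : RGEqH K S.β (S.cpl ⟨K, m, g₀'⟩))
    (hI : Step.InInterval γ K (S.cpl ⟨K, m, g₀⟩)) (hI' : Step.InInterval γ K (S.cpl ⟨K, m, g₀'⟩))
    (hlo : g₀ ≤ y) (hhi : y ≤ g₀') :
    RGEqH K S.β (S.cpl ⟨K, m, y⟩) ∧ Step.InInterval γ K (S.cpl ⟨K, m, y⟩) ∧
      ∀ j, j ≤ K → S.cpl ⟨K, m, g₀⟩ j ≤ S.cpl ⟨K, m, y⟩ j ∧ S.cpl ⟨K, m, y⟩ j ≤ S.cpl ⟨K, m, g₀'⟩ j := by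
  have hlo' : S.cpl ⟨K, m, g₀⟩ 0 ≤ S.cpl ⟨K, m, y⟩ 0 := by rw [hD.d018, hD.d018]; exact hlo
  have hhi' : S.cpl ⟨K, m, y⟩ 0 ≤ S.cpl ⟨K, m, g₀'⟩ 0 := by rw [hD.d018, hD.d018]; exact hhi
  obtain ⟨hrgy, hord⟩ := sandwich hθ0 hθ1 hC hrg hrg' hI hI' hL hΛ hsmall
    (fun k hk hpos hrhs => by
      obtain ⟨h1, h2⟩ := hD.d020 ⟨K, m, y⟩ k hk hpos hrhs
      exact ⟨h1, by linarith⟩) hlo' hhi'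
  exact ⟨hrgy, fun j hj => ⟨((hI j hj).1.trans_le (hord j hj).1), (hord j hj).2.trans (hI' j hj).2⟩, hord⟩

/-- **THE ADMISSIBLE BARE COUPLINGS FORM AN INTERVAL.**  For a setting with the printed `Definitions`, the upper letter (U) `β_{k+1} ≤ b′` on ]0, γ]^{k+1} with
b′γ² < 1 (so that (0.20) holds along every in-]0, γ]-interval run, `hrg_of_betaUpperH`), and part 7's moduli with `4Cγ³ ≤ (1 − θ)²`: for every (K, m) the set of
bare couplings whose run stays in ]0, γ] is ORDER-CONNECTED. [cite: Balaban1987RG1, (0.18)–(0.20) pp.255–256, §1 p.264 and p.298] -/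
theorem admissible_ordConnected (hD : Definitions S) {γ b' θ C : ℝ} {Λ : ℕ → ℕ → ℝ}
    (hθ0 : 0 ≤ θ) (hθ1 : θ < 1) (hC : 0 ≤ C) (hγ : 0 < γ) (hup : BetaUpperH b' γ S.β) (hbγ : b' * γ ^ 2 < 1)
    (hL : HistLipschitz Λ γ S.β) (hΛ : FadingMemory C θ Λ) (hsmall : 4 * C * γ ^ 3 ≤ (1 - θ) ^ 2) (K m : ℕ) :
    Set.OrdConnected {y : ℝ | Step.InInterval γ K (S.cpl ⟨K, m, y⟩)} :=
  ⟨fun x hx z hz _ hy => (cpl_sandwich hD hθ0 hθ1 hC hL hΛ hsmall (hrg_of_betaUpperH hD hγ hup hbγ ⟨K, m, x⟩ hx)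
    (hrg_of_betaUpperH hD hγ hup hbγ ⟨K, m, z⟩ hz) hx hz hy.1 hy.2).2.1⟩

/-- **THE RENORMALIZED COUPLING IS STRICTLY INCREASING ON THE ADMISSIBLE INTERVAL** (same letters; part 7's `bareCoupling_strictMono` as a `StrictMonoOn`
statement). [cite: Balaban1987RG1, Thm 2 p.259 («g₀ = g₀(ε, g)») with (0.18)–(0.20) pp.255–256 and p.298] -/
theorem endpoint_strictMonoOn (hD : Definitions S) {γ b' θ C : ℝ} {Λ : ℕ → ℕ → ℝ}
    (hθ0 : 0 ≤ θ) (hθ1 : θ < 1) (hC : 0 ≤ C) (hγ : 0 < γ) (hup : BetaUpperH b' γ S.β) (hbγ : b' * γ ^ 2 < 1)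
    (hL : HistLipschitz Λ γ S.β) (hΛ : FadingMemory C θ Λ) (hsmall : 4 * C * γ ^ 3 ≤ (1 - θ) ^ 2) (K m : ℕ) :
    StrictMonoOn (fun y : ℝ => S.cpl ⟨K, m, y⟩ K) {y : ℝ | Step.InInterval γ K (S.cpl ⟨K, m, y⟩)} :=
  fun x hx z hz hxz => bareCoupling_strictMono hD hθ0 hθ1 hC hL hΛ hsmall (hrg_of_betaUpperH hD hγ hup hbγ ⟨K, m, x⟩ hx)
    (hrg_of_betaUpperH hD hγ hup hbγ ⟨K, m, z⟩ hz) hx hz hxz K le_rfl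

/-- **END — ON EVERY LATTICE «g₀ = g₀(ε, ·)» IS THE INVERSE OF A STRICTLY INCREASING FUNCTION ON AN INTERVAL, SIGN-FREE.**  `Theorem2Statement S hL` AS TYPED
(a HYPOTHESIS), the printed `Definitions`, the upper letter (U) `β_{k+1} ≤ b′` on ]0, γ_u]^{k+1}, coupling-chart moduli `HistLipschitz Λ γ_u S.β` with
`FadingMemory C θ Λ` (0 ≤ θ < 1, 0 ≤ C), one box size γ₁ ≤ γ_u with b′γ₁² < 1 and 4Cγ₁³ ≤ (1 − θ)² ⟹ for every m there is γ₂ > 0 such that for every γ ≤ γ₂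
there is g₁ > 0 such that on EVERY lattice K: (i) every g ∈ ]0, g₁] is the renormalized coupling of EXACTLY ONE admissible bare coupling (part 7's END), (ii) the
admissible bare couplings (run in ]0, γ]) form an INTERVAL, (iii) on which the renormalized coupling g_K is STRICTLY INCREASING.  No AF letter, no sign, no
uniform reading of (0.31).  A REDUCTION over UNPRINTED letters; nothing of [I] asserted. [cite: Balaban1987RG1, Thm 2 (0.31) p.259 with (0.20) p.256, §1 p.264 and p.298] -/
theorem theorem2_bareCoupling_interval_signFree {hL : Odd S.L ∧ 1 < S.L} (h : Theorem2Statement S hL) (hD : Definitions S)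
    {γu γ₁ b' θ C : ℝ} {Λ : ℕ → ℕ → ℝ} (hup : BetaUpperH b' γu S.β)
    (hL' : HistLipschitz Λ γu S.β) (hΛ : FadingMemory C θ Λ) (hθ0 : 0 ≤ θ) (hθ1 : θ < 1) (hC : 0 ≤ C)
    (hγ₁ : 0 < γ₁) (hγ₁u : γ₁ ≤ γu) (hbu : b' * γ₁ ^ 2 < 1) (hsmall : 4 * C * γ₁ ^ 3 ≤ (1 - θ) ^ 2) (m : ℕ) :
    ∃ γ₂ : ℝ, 0 < γ₂ ∧ ∀ γ : ℝ, 0 < γ → γ ≤ γ₂ → ∃ g₁ : ℝ, 0 < g₁ ∧ ∀ K : ℕ,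
      (∀ g : ℝ, 0 < g → g ≤ g₁ → ∃! g₀ : ℝ, Step.InInterval γ K (S.cpl ⟨K, m, g₀⟩) ∧ S.cpl ⟨K, m, g₀⟩ K = g) ∧
      Set.OrdConnected {y : ℝ | Step.InInterval γ K (S.cpl ⟨K, m, y⟩)} ∧
      StrictMonoOn (fun y : ℝ => S.cpl ⟨K, m, y⟩ K) {y : ℝ | Step.InInterval γ K (S.cpl ⟨K, m, y⟩)} := by
  obtain ⟨γ₂, hγ₂, hγ⟩ := theorem2_existsUnique_of_fadingMemory_signFree h hD hup hL' hΛ hθ0 hθ1 hC hγ₁ hγ₁u hbu hsmall m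
  refine ⟨min γ₂ γ₁, lt_min hγ₂ hγ₁, fun γ hγpos hγle => ?_⟩
  have hγ₁le : γ ≤ γ₁ := hγle.trans (min_le_right _ _)
  have hγule : γ ≤ γu := hγ₁le.trans hγ₁u
  obtain ⟨g₁, hg₁, hg⟩ := hγ γ hγpos (hγle.trans (min_le_left _ _))
  have hup' : BetaUpperH b' γ S.β := fun k v hv => hup k v (box_mono hγule k hv)
  have hLγ : HistLipschitz Λ γ S.β := fun k p q hp hq => hL' k p q (box_mono hγule k hp) (box_mono hγule k hq)
  have hbγ : b' * γ ^ 2 < 1 := by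
    rcases le_or_gt 0 b' with hb' | hb'
    · exact lt_of_le_of_lt (mul_le_mul_of_nonneg_left (pow_le_pow_left₀ hγpos.le hγ₁le 2) hb') hbu
    · nlinarith [sq_nonneg γ]
  have hsmallγ : 4 * C * γ ^ 3 ≤ (1 - θ) ^ 2 :=
    (mul_le_mul_of_nonneg_left (pow_le_pow_left₀ hγpos.le hγ₁le 3) (by positivity)).trans hsmall
  exact ⟨g₁, hg₁, fun K => ⟨fun g hgpos hgle => hg g hgpos hgle K,
    admissible_ordConnected hD hθ0 hθ1 hC hγpos hup' hbγ hLγ hΛ hsmallγ K m,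
    endpoint_strictMonoOn hD hθ0 hθ1 hC hγpos hup' hbγ hLγ hΛ hsmallγ K m⟩⟩

end

end Summit.QuantumFields.BalabanUV.Beta.EriceFlowEnclosureB12AsPrintedPointwiseFadingOrderInterval
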